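import Summits.HodgeConjecture.HodgeConjecture.Theorems.PadicSemiregularLiftHodgeAbelianVarietiesAndreStub
import Summits.HodgeConjecture.HodgeConjecture.Theorems.PadicSemiregularLiftHodgeAbelianVarietiesStubHomPullback
import Summits.HodgeConjecture.HodgeConjecture.Theses.RankFourFaces
import Summits.HodgeConjecture.HodgeConjecture.Theses.PadicSemiregularLift
import Literature.AlgebraicGeometry.HodgeTheory.HodgeModelExistence
import Literature.AlgebraicGeometry.HodgeTheory.ComplexConjugationHolds

/-!
# Crux `HodgeAbelianVarieties` (stmt-HodgeConjecture-1333), line `cm-pivot-andre` — the ANDRÉ REDUCTION, kernel-checked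

With stubs 1 (`stub_andreSplitWeilCM`, André's decomposition with CM targets) and 3 (`stub_homPullback`) of the line
PROVED, the composition `cmAbelianHodge_of` of `Lines/cm_pivot_andre.lean` becomes an unconditional theorem of the tree:
the Hodge conjecture for complex abelian varieties of CM type (`RankFourFaces.CMAbelianHodge`, the shared item
stmt-HodgeConjecture-3052) FOLLOWS from the single open statement `CMWeilClassesAlgebraic` — algebraicity of the rational
`(p,p)` Weil eigen-classes on abelian varieties with a CM subalgebra — and the crux `HodgeAbelianVarieties` from that and
`RankFourFaces.CMToAbelian` (stmt-16267). This is André's 1992 reduction (Markman, arXiv:2509.23403, Thm. 1.4), typed over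
the tree's real carriers and kernel-checked end to end.
-/

set_option linter.dupNamespace false

noncomputable section

namespace Summit.HodgeConjecture.HodgeConjecture.Theorems.HodgeAbelianVarieties.CMPivotAndre

open CategoryTheory
open Literature.AlgebraicGeometry Literature.AlgebraicGeometry.Motives Literature.AlgebraicGeometry.HodgeTheory
open Summit.HodgeConjecture.HodgeConjecture.Theses

/-- `IsCMSub[A]` — the CM hypothesis of the item VERBATIM. Local notation only. -/
local notation3 (prettyPrint := false) "IsCMSub[" A "]" =>
  ∃ S : Subalgebra ℚ (AbelianVariety.endAlgebra A), IsReduced ↥S ∧ (∀ x ∈ S, ∀ y ∈ S, x * y = y * x) ∧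
    Module.finrank ℚ ↥S = 2 * AbelianVariety.dim A

/-- `CMWeilClassesAlgebraic[]` — stub 2 of `Lines/cm_pivot_andre.lean` VERBATIM (the open core: rational `(p,p)` Weil
eigen-classes on abelian varieties with a CM subalgebra are algebraic). Local notation only. -/
local notation3 (prettyPrint := false) "CMWeilClassesAlgebraic[]" =>
  ∀ (A : AbelianVariety ℂ), IsCMSub[A] → ∀ (ψ : A ⟶ A) (p : ℕ) (S : Finset ℂ), 0 < p →
    (∀ μ ∈ S, μ.im ≠ 0) →
    (⨆ μ ∈ S, Module.End.eigenspace (complexBetti.map ψ.hom.hom.hom 1).hom μ) = ⊤ →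
    (∀ μ ∈ S, Module.finrank ℂ (Module.End.eigenspace (complexBetti.map ψ.hom.hom.hom 1).hom μ) = 2 * p) →
    ∀ c : complexBetti A.X (2 * p), IsRationalClass c → IsOfHodgeType A.dim A.X (2 * p) p p c →
      c ∈ (⨆ μ ∈ S, pullbackEigenclasses A ψ (2 * p) (fun x y => ((x : ℂ) + (y : ℂ) * μ) ^ (2 * p))) →
      c ∈ algebraicClasses A.X p

/-- **André's reduction, kernel-checked**: algebraicity of the rational `(p,p)` Weil eigen-classes on complex abelian
varieties with a CM subalgebra implies the Hodge conjecture for all complex abelian varieties of CM type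
(`RankFourFaces.CMAbelianHodge`, stmt-HodgeConjecture-3052). Composition of the PROVED stubs 1 (`stub_andreSplitWeilCM`)
and 3 (`stub_homPullback`) of line `cm-pivot-andre` exactly as in its `cmAbelianHodge_of`.
[cite: Andre1992HodgeCM, Théorème] [cite: Markman2025SurveySecant, Thm. 1.4] -/
theorem cmAbelianHodge_of_cmWeilClassesAlgebraic : CMWeilClassesAlgebraic[] → Summit.HodgeConjecture.HodgeConjecture.Theses.RankFourFaces.CMAbelianHodge := by
  intro hW A hA hS
  refine (hodgeConjectureFor_iff_of_isSmoothProjective nonempty_hodgeModel_holds hA).2 ?_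
  intro p c hc hpp
  rcases Nat.eq_zero_or_pos p with rfl | hp
  · exact hodgeConjectureFor_codim_zero c
  obtain ⟨m, B, f, ψ, S, t, hCM, hS', htop, hrk, hrat, hhodge, hweil, rfl⟩ :=
    stub_andreSplitWeilCM A hS p hp c hc hpp
  refine Submodule.sum_mem _ fun i _ ↦ stub_homPullback A (B i) (f i) p (t i) ?_
  exact hW (B i) (hCM i) (ψ i) p (S i) hp (hS' i) (htop i) (hrk i) (t i) (hrat i) (hhodge i) (hweil i)

/-- **The crux from the open core and the transport piece**: `CMWeilClassesAlgebraic ∧ CMToAbelian (stmt-16267) ⟹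
HodgeAbelianVarieties` (stmt-1333), concluded BY NAME. [cite: Andre1992HodgeCM, Théorème]
[cite: Deligne1982HodgeCycles, Prop. 6.1] -/
theorem hodgeAbelianVarieties_of_cmWeilClassesAlgebraic_of_cmToAbelian :
    CMWeilClassesAlgebraic[] → RankFourFaces.CMToAbelian → PadicSemiregularLift.HodgeAbelianVarieties :=
  fun hW hT A ↦ hT (cmAbelianHodge_of_cmWeilClassesAlgebraic hW) A (AbelianVariety.isSmoothProjective_holds (A := A))

end Summit.HodgeConjecture.HodgeConjecture.Theorems.HodgeAbelianVarieties.CMPivotAndre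

end
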